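import Literature.AlgebraicGeometry.Motives.CrystallineRealization
import Literature.AlgebraicGeometry.Motives.VarietiesUnitProofs
import HarnessLib

-- 2026-08-15 (provefact seat `CycleClassIsChernCharacter`, verdict not-a-fact): explicit binder `(C)` on
-- the PREDICATE `CycleClassIsChernCharacter` (a hypothesis schema relative to `C`, exactly as
-- `BerthelotOgusLineBundleLifting C`; name, statement and argument order unchanged) + the zero-Chern
-- re-decoration `zeroChern` refuting its universal closure (`not_cycleClassIsChernCharacter_zeroChern`,
-- `forall_cycleClassIsChernCharacter_iff_isEmpty`); Fulton, Example 15.2.16 (b) re-read.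
/-!
# Crystalline Chern characters of `K₀ ⊗ ℚ`-classes and cycle classes (Riemann–Roch link)

Companion to `Motives/CrystallineRealization` (the hypothesis structure `CrystallineRealization p k`:
rational crystalline cohomology of `k`-varieties with Frobenius `frobK`, cycle classes, the
crystalline Chern character `chCris` of `𝒪`-modules, the Berthelot–Ogus maps `bo`). That file types
the Bloch–Esnault–Kerz Hodge condition `C.HodgeCondition 𝒳 E₁` for ONE module `E₁` on the special
fibre. The `p`-adic lifting criterion (Bloch–Esnault–Kerz 2014, Thm. 1.3) and the algebraization
problem `K₀(X) → lim K₀(X_n)` (loc. cit. §1; the crux ALG of route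
`HodgeConjecture/SupersingularIsotypicLift`) concern classes `ξ₁ ∈ K₀(X₁) ⊗ ℚ`, and the route feeds
them CYCLE classes of the reduction. This file supplies exactly that vocabulary, relative to a fixed
`C : CrystallineRealization p k` (the named-fact pattern of the parent file):

* `C.chCrisQ X c r` — the crystalline Chern character of a formal `ℚ`-combination
  `c : 𝒪_X-Mod →₀ ℚ` of modules (a presentation of a class of `K₀(X) ⊗ ℚ` by vector bundles; the
  tree has no `K₀` of a scheme yet, wanted notion `KZeroRat`), with `chCrisQ_single/_add/_zero`
  and its Frobenius weight `frobK_chCrisQ` (`φ = pʳ` on `ch_r`, PROVED from the parent's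
  `frobK_chCris`: `σ` fixes `ℚ`);
* `C.HodgeConditionQ 𝒳 c` — "`Φ⁻¹ ∘ ch(ξ₁) ∈ ⊕ᵣ Fʳ H²ʳ_dR(X_K/K)`" for such a class
  (Bloch–Esnault–Kerz 2014, Thm. 1.3 (a)), extending `HodgeCondition` (`hodgeConditionQ_single`);
* the HYPOTHESIS SCHEMA `CycleClassIsChernCharacter C` (a `Prop`-valued PREDICATE of the explicit
  datum `C`, consumed as `(h : C.CycleClassIsChernCharacter)`; not a closed named fact, see below) —
  the Riemann–Roch link in the form the route consumes: on a smooth projective `X/k` the class of a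
  codimension-`r` prime cycle is `ch_r(ξ)` for a `ℚ`-combination `ξ` of vector bundles with
  `ch_j(ξ) = 0` for `j ≠ r`. Sources read: Fulton, *Intersection Theory*, Example 15.2.16 (b)
  ("the Chern character determines an isomorphism `ch : K(X)_ℚ ⥲ A(X)_ℚ` of `ℚ`-algebras", `X`
  non-singular; re-read 2026-08-15 from the printed page), and Gros 1985 (Mém. SMF 21), whose
  logarithmic Hodge–Witt theory carries both the Chern classes of locally free modules (III.1,
  recovering the crystalline Chern classes of Berthelot–Illusie, III.2) and the classes of arbitrary
  cycles (II.4), multiplicative on proper intersections (II.4.2.13) and satisfying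
  `c_r(i_* 𝒪_Y) = (-1)^{r-1}(r-1)! cl(Y/X)` (Introduction (10), IV.3), so that `ch^cris = cl ∘ ch^A`
  on `K₀ ⊗ ℚ`; Gillet–Messing 1987 (*Cycle classes and Riemann–Roch for crystalline cohomology*,
  Duke 55 — not consulted, paywalled) is the reference used by Costa–Sertöz 2021, §2.1.4 for the
  crystalline cycle class map;
* PROVED consequences: `exists_hodgeConditionQ_of_cycleClass` (an unobstructed cycle class of the
  reduction — Costa–Sertöz 2021, Def. 2.6 — is the Chern character of a `K₀ ⊗ ℚ`-class satisfying
  BEK's condition (a), ready for Thm. 1.3), `algebraicClasses_le_span_chCrisQ` (algebraic classes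
  are `K`-combinations of Chern characters of such classes), and `frobK_mem_algebraicClasses`
  (`φ`-stability of the span of cycle classes; Ogus 1982, (2.4): "`F(s)` acts on `W(s) ⊗ V` as
  `pʳ F_{W(s)} ⊗ id_V`");
* WHY `CycleClassIsChernCharacter` IS A PREDICATE AND NOT A FACT (verdict of its prove-seat,
  2026-08-15): the sources prove it for THE crystalline realization (classical `K₀`, Chow groups and
  Gros' cycle classes), which the tree does not construct; nothing in the fields of an abstract
  `C : CrystallineRealization p k` pins `C.chCris` to the classical Chern character — the fields
  constrain `chCris` only by invariance, functoriality, additivity, algebraicity and the comparison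
  `bo ∘ ch^cris = ch^dR`, all of which the ZERO function satisfies. The re-decoration `C.zeroChern`
  (same Weil cohomology, lattices, Frobenius, de Rham side and comparison maps; `chCris := 0`,
  `chDR := 0`) is again a `CrystallineRealization p k`, and `C.zeroChern.CycleClassIsChernCharacter`
  fails (`not_cycleClassIsChernCharacter_zeroChern`): on `X = Spec k = 𝟙_ (SchemeOver k)` (smooth
  projective of dimension `0`, `isSmoothProjective_unit_holds`) the class of the generic point is
  the unit `1 ≠ 0` of `H⁰` (`cycleClass_of_coheight_eq_zero`, `one_cup`, `bijective_trace`), not a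
  combination of zero Chern characters. Hence the universal closure `∀ C, C.CycleClassIsChernCharacter`
  holds iff the structure has no value at all (`forall_cycleClassIsChernCharacter_iff_isEmpty`): there
  is nothing to discharge, exactly as for `BerthelotOgusLineBundleLifting C` (parent file) and the
  `B`-parametrised statements of `Motives/Sweep1`.

Not here: `K₀`, `lim_n K₀(X_n)`, Thm. 1.3 itself (needs `KZeroRat`); multiplicativity of `ch`.
-/

universe u

open CategoryTheory AlgebraicGeometry
open scoped Isocrystal

noncomputable section

namespace Literature.AlgebraicGeometry.Motives

namespace CrystallineRealization

open WittScheme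

variable {p : ℕ} [Fact p.Prime] {k : Type u} [Field k] [CharP k p] [PerfectRing k p]
  (C : CrystallineRealization p k)

/-! ### Chern characters of formal `ℚ`-combinations of modules -/

/-- The degree-`2r` crystalline Chern character `ch_r(ξ) = Σ_E a_E · ch_r(E) ∈ H²ʳ(X)` of a formal
`ℚ`-combination `ξ = Σ a_E [E]` of `𝒪_X`-modules (meaningful when the support consists of vector
bundles: a presentation of a class of `K₀(X) ⊗ ℚ`, on which the crystalline Chern character is
defined by additivity; Bloch–Esnault–Kerz 2014, §2: `ch : K₀(X₁) → ⊕ᵣ H²ʳ_cris(X₁/W)_ℚ`).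
[cite: BlochEsnaultKerz2014pAdic, §2 (crystalline Chern character, last display of §2)] -/
def chCrisQ (X : SchemeOver k) (c : X.left.Modules →₀ ℚ) (r : ℕ) : C.obj X (2 * r) :=
  c.sum fun E a => ((a : ℚ) : K(p, k)) • C.chCris X E r

section chCrisQ

variable (X : SchemeOver k) (r : ℕ)

/-- `ch_r` of the empty combination is `0`. [folklore] -/
@[simp]
theorem chCrisQ_zero : C.chCrisQ X 0 r = 0 := by
  simp [chCrisQ]

/-- `ch_r(a [E]) = a · ch_r(E)`. [folklore] -/
@[simp]
theorem chCrisQ_single (E : X.left.Modules) (a : ℚ) :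
    C.chCrisQ X (Finsupp.single E a) r = ((a : ℚ) : K(p, k)) • C.chCris X E r := by
  simp [chCrisQ]

/-- `ch_r` is additive in the formal combination. [folklore] -/
theorem chCrisQ_add (c c' : X.left.Modules →₀ ℚ) :
    C.chCrisQ X (c + c') r = C.chCrisQ X c r + C.chCrisQ X c' r :=
  Finsupp.sum_add_index' (fun _ => by simp) fun _ _ _ => by simp [add_smul]

variable {X} {n : ℕ}

/-- **Frobenius weight** `φ(ch_r(ξ)) = pʳ · ch_r(ξ)` for a formal `ℚ`-combination `ξ` on a smooth
projective `X/k` (the parent's `frobK_chCris`, `φ` being `σ`-semilinear and `σ` fixing `ℚ`).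
[cite: Ogus1982, §0 and (2.4)] -/
theorem frobK_chCrisQ (hX : IsSmoothProjective n X) (c : X.left.Modules →₀ ℚ) (r : ℕ) :
    C.frobK X (2 * r) (C.chCrisQ X c r) = ((p : K(p, k)) ^ r) • C.chCrisQ X c r := by
  simp only [chCrisQ, Finsupp.sum, map_sum, LinearEquiv.map_smulₛₗ, map_ratCast,
    Finset.smul_sum]
  refine Finset.sum_congr rfl fun E _ => ?_
  rw [C.frobK_chCris hX E r, smul_comm]

end chCrisQ

/-! ### The Hodge condition for `K₀ ⊗ ℚ`-classes -/

/-- The **Hodge condition** for a formal `ℚ`-combination `ξ₁` of modules on the special fibre of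
`𝒳/W`: "`Φ⁻¹ ∘ ch(ξ₁) ∈ ⊕ᵣ Fʳ H²ʳ_dR(X_K/K)`", i.e. every `ch_r(ξ₁)` is carried by the
Berthelot–Ogus map into `Fʳ` (Bloch–Esnault–Kerz 2014, Thm. 1.3 (a), for `ξ₁ ∈ K₀(X₁)_ℚ`;
Costa–Sertöz 2021, Def. 2.6 "unobstructed"). [cite: BlochEsnaultKerz2014pAdic, Thm. 1.3 (a)] -/
def HodgeConditionQ (𝒳 : SchemeOver (WittVector p k))
    (c : (specialFibre 𝒳).left.Modules →₀ ℚ) : Prop :=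
  ∀ r : ℕ, C.bo 𝒳 (2 * r) (C.chCrisQ (specialFibre 𝒳) c r) ∈ C.dR.fil (2 * r) r

/-- On a single module, `HodgeConditionQ [E] ↔ HodgeCondition E`. [folklore] -/
theorem hodgeConditionQ_single (𝒳 : SchemeOver (WittVector p k))
    (E : (specialFibre 𝒳).left.Modules) :
    C.HodgeConditionQ 𝒳 (Finsupp.single E 1) ↔ C.HodgeCondition 𝒳 E := by
  simp [HodgeConditionQ, HodgeCondition]

/-! ### Cycle classes are Chern characters (hypothesis schema) and consequences -/

/-- **Riemann–Roch link between cycle classes and the crystalline Chern character**, a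
`Prop`-valued PREDICATE of the explicit datum `C` (hypothesis schema relative to `C`, the consumed
form `(h : C.CycleClassIsChernCharacter)`; written with the explicit binder `(C)` so that it is not
read as a closed named fact — there is nothing to discharge, its universal closure over `C` being
refuted by `not_cycleClassIsChernCharacter_zeroChern` below): on a smooth projective variety
`X/k`, the class of the prime cycle of a codimension-`r` point `z` is the degree-`r` crystalline
Chern character of a formal `ℚ`-combination `ξ` of VECTOR BUNDLES whose Chern character is pure of
degree `r` (`ch_r(ξ) = cl z`, `ch_j(ξ) = 0` for `j ≠ r`). For the classical realization:
`ch : K(X)_ℚ ⥲ A(X)_ℚ` is an isomorphism of `ℚ`-algebras for `X` non-singular (Fulton,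
Example 15.2.16 (b)), so some `ξ ∈ K(X)_ℚ` has Chow-valued Chern character exactly
`[closure z] ∈ Aʳ(X)_ℚ`, and the crystalline Chern character is the cycle class of the Chow-valued
one (Gros 1985: Chern classes III.1–2 and cycle classes II.4 in logarithmic Hodge–Witt cohomology,
multiplicative (II.4.2.13), with `c_r(i_*𝒪_Y) = (-1)^{r-1}(r-1)! cl(Y/X)`, Introduction (10) /
IV.3; Gillet–Messing 1987). Nothing in the fields of an abstract `C` pins `C.chCris` to that
classical Chern character, whence the predicate form.
[cite: Fulton1998, Example 15.2.16 (b)] [cite: Gros1985, II.4 (4.2.13), III.1–III.2 and Introduction (10)] [cite: CostaSertoz2021, §2.1.4] -/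
def CycleClassIsChernCharacter (C : CrystallineRealization p k) : Prop :=
  ∀ ⦃n : ℕ⦄ ⦃X : SchemeOver k⦄, IsSmoothProjective n X → ∀ (r : ℕ) (z : X.left),
    Order.coheight z = r →
      ∃ c : X.left.Modules →₀ ℚ, (∀ E ∈ c.support, IsVectorBundle E) ∧
        C.chCrisQ X c r = C.cycleClass X r z ∧ ∀ j : ℕ, j ≠ r → C.chCrisQ X c j = 0

variable {n : ℕ}

/-- **Unobstructed cycle classes of the reduction are Chern characters of `K₀ ⊗ ℚ`-classes
satisfying BEK's Hodge condition (a)**: if the class of a codimension-`r` point `z` of the special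
fibre of a smooth proper `𝒳/W` is carried into `Fʳ H²ʳ_dR(X_K/K)` (Costa–Sertöz 2021, Def. 2.6),
then, under `CycleClassIsChernCharacter C`, it is `ch_r(ξ₁)` for a formal `ℚ`-combination `ξ₁` of
vector bundles on `X_k` with `HodgeConditionQ 𝒳 ξ₁` — the hypothesis of Bloch–Esnault–Kerz 2014,
Thm. 1.3. [cite: BlochEsnaultKerz2014pAdic, Thm. 1.3 (a)] [cite: CostaSertoz2021, Def. 2.6 and Thm. 2.7] -/
theorem exists_hodgeConditionQ_of_cycleClass (h : C.CycleClassIsChernCharacter)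
    {𝒳 : SchemeOver (WittVector p k)} (h𝒳 : IsSmoothProperModel n 𝒳) (r : ℕ)
    (z : (specialFibre 𝒳).left) (hz : Order.coheight z = r)
    (hHodge : C.bo 𝒳 (2 * r) (C.cycleClass (specialFibre 𝒳) r z) ∈ C.dR.fil (2 * r) r) :
    ∃ c : (specialFibre 𝒳).left.Modules →₀ ℚ, (∀ E ∈ c.support, IsVectorBundle E) ∧
      C.chCrisQ (specialFibre 𝒳) c r = C.cycleClass (specialFibre 𝒳) r z ∧
        C.HodgeConditionQ 𝒳 c := by
  obtain ⟨c, hc, hcr, hcj⟩ := h h𝒳.isSmoothProjective_specialFibre r z hz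
  refine ⟨c, hc, hcr, fun j => ?_⟩
  by_cases hj : j = r
  · subst hj
    rw [hcr]
    exact hHodge
  · rw [hcj j hj, map_zero]
    exact zero_mem _

variable {X : SchemeOver k}

/-- Under `CycleClassIsChernCharacter C`, every algebraic class of codimension `r` on a smooth
projective `X/k` is a `K`-combination of degree-`r` Chern characters of formal `ℚ`-combinations of
vector bundles. [cite: Fulton1998, Example 15.2.16 (b)] -/
theorem algebraicClasses_le_span_chCrisQ (h : C.CycleClassIsChernCharacter)
    (hX : IsSmoothProjective n X) (r : ℕ) :
    C.algebraicClasses X r ≤ Submodule.span K(p, k)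
      (Set.range fun c : {c : X.left.Modules →₀ ℚ // ∀ E ∈ c.support, IsVectorBundle E} =>
        C.chCrisQ X c.1 r) := by
  refine Submodule.span_le.mpr ?_
  change C.algebraicLattice X r ≤ (Submodule.span K(p, k) _).toAddSubgroup
  refine (AddSubgroup.closure_le _).mpr ?_
  rintro _ ⟨⟨z, hz⟩, rfl⟩
  obtain ⟨c, hc, hcr, -⟩ := h hX r z hz
  exact Submodule.subset_span ⟨⟨c, hc⟩, hcr⟩

/-- The `K`-span of the cycle classes of a smooth projective `X/k` is `φ`-stable:
`φ(Σ aᵢ · cl zᵢ) = Σ σ(aᵢ) pʳ · cl zᵢ` ("`F(s)` acts on `W(s) ⊗ V` as `pʳ F_{W(s)} ⊗ id_V`", `V`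
the `ℚ`-span of cycle classes; from the parent's `frobK_cycleClass`). [cite: Ogus1982, (2.4)] -/
theorem frobK_mem_algebraicClasses (hX : IsSmoothProjective n X) (r : ℕ) {x : C.obj X (2 * r)}
    (hx : x ∈ C.algebraicClasses X r) : C.frobK X (2 * r) x ∈ C.algebraicClasses X r := by
  induction hx using Submodule.span_induction with
  | mem y hy =>
      rw [C.algebraicLattice_le_tateClasses hX r hy]
      exact Submodule.smul_mem _ _ (Submodule.subset_span hy)
  | zero => simp
  | add y z _ _ hy hz => simpa [map_add] using add_mem hy hz
  | smul a y _ hy => simpa [LinearEquiv.map_smulₛₗ] using Submodule.smul_mem _ _ hy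

/-! ### The zero-Chern re-decoration: why `CycleClassIsChernCharacter` is a hypothesis schema -/

/-- The **zero-Chern re-decoration** of `C`: the same rational and integral crystalline cohomology,
Frobenius, de Rham realization and Berthelot–Ogus maps, with both Chern characters replaced by the
zero function. Every field of `CrystallineRealization` that mentions `chCris`/`chDR` (invariance
under isomorphism, functoriality, additivity on short exact sequences, algebraicity, the comparison
`bo (ch^cris) = ch^dR`) holds trivially for `0`, so this is again a value of the structure; it
witnesses that the fields do not pin `chCris` to the classical crystalline Chern character.
[folklore] -/
def zeroChern (C : CrystallineRealization p k) : CrystallineRealization p k :=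
  { C with
    chCris := fun _ _ _ => 0
    chDR := fun _ _ _ => 0
    chCris_congr := fun _ _ _ _ _ => rfl
    chDR_congr := fun _ _ _ _ _ => rfl
    pullback_chCris := fun _ _ _ _ _ _ => map_zero _
    pullback_chDR := fun _ _ _ _ _ _ => map_zero _
    chCris_shortExact := fun _ _ _ _ _ _ => (add_zero _).symm
    chDR_shortExact := fun _ _ _ _ _ _ => (add_zero _).symm
    chCris_mem_ratAlgebraicClasses := fun _ _ _ _ _ => zero_mem _
    chDR_mem_ratAlgebraicClasses := fun _ _ _ _ _ => zero_mem _
    bo_chCris := fun _ _ _ _ _ _ => map_zero _ }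

/-- The re-decoration keeps the underlying Weil cohomology theory (in particular `cycleClass`,
`one`, `cup`, `trace`). [folklore] -/
@[simp]
theorem zeroChern_toWeilCohomology : C.zeroChern.toWeilCohomology = C.toWeilCohomology := rfl

/-- The re-decorated crystalline Chern character is `0`. [folklore] -/
@[simp]
theorem zeroChern_chCris (X : SchemeOver k) (E : X.left.Modules) (r : ℕ) :
    C.zeroChern.chCris X E r = 0 := rfl

/-- The re-decorated de Rham Chern character is `0`. [folklore] -/
@[simp]
theorem zeroChern_chDR (Y : SchemeOver K(p, k)) (E : Y.left.Modules) (r : ℕ) :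
    C.zeroChern.chDR Y E r = 0 := rfl

/-- Under the re-decoration every formal `ℚ`-combination has Chern character `0`. [folklore] -/
@[simp]
theorem zeroChern_chCrisQ (X : SchemeOver k) (c : X.left.Modules →₀ ℚ) (r : ℕ) :
    C.zeroChern.chCrisQ X c r = 0 := by
  simp only [chCrisQ, Finsupp.sum, zeroChern_chCris, smul_zero, Finset.sum_const_zero]

/-- The re-decoration keeps the cycle classes. [folklore] -/
theorem zeroChern_cycleClass (X : SchemeOver k) (r : ℕ) (z : X.left) :
    C.zeroChern.cycleClass X r z = C.cycleClass X r z := rfl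

/-- The unit `1 ∈ H⁰(X)` of a smooth projective `X` is nonzero: `1 ∪ a = a` for all `a ∈ H²ⁿ(X)`
(`one_cup`) and `H²ⁿ(X) ≠ 0`, the trace being onto `K` (`bijective_trace`; Kleiman 1968,
§1.2 (A)). (The same statement is `WeilCohomology.unit_ne_zero` in `Motives/AbelianVarietyHopf`,
not imported here.) [folklore] -/
theorem one_ne_zero_of_isSmoothProjective {X : SchemeOver k} (hX : IsSmoothProjective n X) :
    C.one X ≠ 0 := by
  intro h0
  obtain ⟨a, ha⟩ := (C.bijective_trace hX).2 1
  have : a = 0 := by rw [← C.one_cup hX (Nat.zero_add _) a, h0, LinearMap.map_zero₂]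
  rw [this, map_zero] at ha
  exact zero_ne_one ha

open MonoidalCategory in
/-- The generic point of `Spec k = 𝟙_ (SchemeOver k)` has codimension `0` (it is maximal for the
specialisation order `a ≤ b ↔ b ⤳ a` of `Scheme`). [folklore] -/
theorem coheight_genericPoint_unit
    [IrreducibleSpace ↥(𝟙_ (SchemeOver k)).left] :
    Order.coheight (genericPoint ↥(𝟙_ (SchemeOver k)).left) = 0 := by
  rw [Order.coheight_eq_zero]
  intro b _
  exact Scheme.le_iff_specializes.2 ((genericPoint_spec _).specializes (Set.mem_univ b))

open MonoidalCategory in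
/-- **The universal closure of `CycleClassIsChernCharacter` fails for the zero-Chern
re-decoration of every `C`.** On `X = Spec k = 𝟙_ (SchemeOver k)`, smooth projective of dimension
`0` (`isSmoothProjective_unit_holds`), the class of the generic point is the unit `1 ∈ H⁰(X)`
(`cycleClass_of_coheight_eq_zero`), which is nonzero (`one_ne_zero_of_isSmoothProjective`), whereas
every Chern character of `C.zeroChern` vanishes. So `CycleClassIsChernCharacter` is a genuine
hypothesis on `C` (true for the classical crystalline realization by Fulton, Example 15.2.16 (b)
and Gros 1985 / Gillet–Messing 1987; false for `C.zeroChern`), not a statement with a universal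
discharge. [folklore] -/
theorem not_cycleClassIsChernCharacter_zeroChern (C : CrystallineRealization p k) :
    ¬ C.zeroChern.CycleClassIsChernCharacter := by
  intro h
  have hX : IsSmoothProjective 0 (𝟙_ (SchemeOver k)) := isSmoothProjective_unit_holds k
  haveI := hX.geometricallyIrreducible
  haveI : IrreducibleSpace ↥(𝟙_ (SchemeOver k)).left :=
    GeometricallyIrreducible.irreducibleSpace_of_subsingleton (𝟙_ (SchemeOver k)).hom
  have hη := coheight_genericPoint_unit (k := k)
  obtain ⟨c, -, hc, -⟩ := h hX 0 (genericPoint ↥(𝟙_ (SchemeOver k)).left) hη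
  rw [zeroChern_chCrisQ, zeroChern_cycleClass, C.cycleClass_of_coheight_eq_zero hX _ hη] at hc
  exact C.one_ne_zero_of_isSmoothProjective hX hc.symm

/-- **Verdict form**: the closed statement `∀ C, C.CycleClassIsChernCharacter` holds if and only if
the hypothesis structure `CrystallineRealization p k` has no value at all — it is refuted by the
zero-Chern re-decoration of any value (`not_cycleClassIsChernCharacter_zeroChern`), in particular
of the classical one. Hence `CycleClassIsChernCharacter` is consumed as a hypothesis
`(h : C.CycleClassIsChernCharacter)` and never discharged uniformly in `C`. [folklore] -/
theorem forall_cycleClassIsChernCharacter_iff_isEmpty :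
    (∀ C : CrystallineRealization p k, C.CycleClassIsChernCharacter) ↔
      IsEmpty (CrystallineRealization p k) :=
  ⟨fun h => ⟨fun C => not_cycleClassIsChernCharacter_zeroChern C (h C.zeroChern)⟩,
    fun h C => (h.false C).elim⟩

end CrystallineRealization

end Literature.AlgebraicGeometry.Motives

end
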